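/-
Copyright: the b2b-balaban T⁴-continuum CRUX team, row NE7b leaf lineage `t4-ne7b-formalise-leaf-05` (gen 156). Project licence.
-/
import Summits.QuantumFields.BalabanUV.T4Continuum.Spine.NE7b.NonAbelianStokesPathPair

/-!
# (NAS) part 5b — WHERE THE PATH-PAIR SCRIPT GLUES ITS PLAQUETTES: the glued list of `toFront` ∕ of the commuting instance `Γ S` vs `S Γ`
# (`S = c^L` a straight segment) IN CLOSED FORM — letter `γ_m` of `Γ` sweeps the straight strip of `L` unit squares
# `x + disp(γ_1 ⋯ γ_{m−1}) + k·vec c + swapShift c γ_m`, `k = 0, …, L − 1` (none when `γ_m ∥ c`) — the datum a multiplicity count of the swept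
# plaquettes over a family of base points needs (row NE7b, node U5c; Lemma CS (ii) ∕ (5.2)'s counting — `CovariantStokesCounting` — for the pair
# «tree contour then segment» vs «segment then translated contour»)

Cell `pub-balaban`, sub-cell `t4`, spine estimate NE7b (`T4WeightBudget.RelWeightBound`; the cell's OWN estimate — NOT PRINTED in [Bałaban 1983–89],
NOT PROVED).  Crux-route work under `Spine/NE7b/` by a row leaf; [folklore] list bookkeeping; NOTHING of Bałaban's is named, asserted or valued; no
`T4Continuum/Support` leaf typed; TWO data definitions (`sweep`, `commGlued` — the closed-form glued lists; list-valued, no `Prop`-valued definition);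
zero `sorry`.  Imports this lineage's `NonAbelianStokesPathPair` ONLY (`toFront`, `sortMoves`, `towerMoves`, `pathPairScript`, `build_toFront_append`,
`erase_replicate_append_cons`, `glued_towerMoves_append`; through it `NonAbelianStokesTransposition.glued_swapMoves_append`, `swapShift`, `swapOrient`).

WHAT IS PROVED ([folklore]):
* §1 DATA `sweep x l X A` (the plaquettes glued while `l` is carried leftward past the letters of `A` sitting after the prefix `X`: for the `k`-th letter
  `a_k` of `A`, nothing if `a_k ∥ l`, else the unit square at `x + disp(X ++ a_0 ⋯ a_{k−1}) + swapShift a_k l` with orientation `swapOrient a_k l`);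
  **`glued_toFront_append_of_not_mem`** (`l ∉ A`, `build rest = X ++ (A ++ l :: B) ++ Z`, `|X| = n` ⟹
  `glued x (toFront l n (A ++ l :: B) ++ rest) = sweep x l X A ++ glued x rest`); `sweep_replicate` (past a straight segment `c^L` the swept squares are
  the strip `x + disp X + k·vec c + swapShift c l`, `k < L`, or nothing if `c ∥ l`).
* §2 DATA `commGlued x c L X Γ` and **`glued_sortMoves_comm_replicate`** (`build rest = X ++ (c^L ++ Γ) ++ Z`, `|X| = n` ⟹
  `glued x (sortMoves n (Γ ++ c^L) (c^L ++ Γ) ++ rest) = commGlued x c L X Γ ++ glued x rest`), **`glued_pathPairScript_comm_replicate`**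
  (`glued x (pathPairScript (Γ ++ c^L) (c^L ++ Γ)) = commGlued x c L [] Γ` — THE SWEPT REGION IN CLOSED FORM: letter `γ_m` of `Γ` contributes the
  strip based at `x + disp(γ_1 ⋯ γ_{m−1})`, deeper letters listed first).
* §3 toy: `Γ = a⁺` past `S = b⁺b⁺` — two squares, at `x` and `x + e_b`.

NOT HERE (honest): the multiplicity count over the block's base points ((5.2) ∕ `CovariantStokesCounting`'s letters `m₁`, `m₂` — (A3) arithmetic on
these lists); which paths are Bałaban's ((A3) ∕ (A1c), NC-NE7b-α UNRULED).  BY-NAME EFFECT ON THE WALL: NONE.  NE7b NOT PRINTED ∕ NOT PROVED; spine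
PROVED 0∕9; rung (B)+1 on a FINITE torus — NOT infinite volume, NOT the mass gap, NOT Clay.  HONEST DEPENDENCY: continuum YM on T⁴ ⇐ BetaPertH ∧ nine
spine estimates (0/9 proved); BetaPertH ⇐ (D1) ∧ (D4) ∧ CAP+tail; G-an2-4 gates asym, D1 and NE2/3/4.
-/

set_option autoImplicit false

namespace Summit.QuantumFields.BalabanUV.T4Continuum.NE7b.NonAbelianStokesPathPairLocus

open Literature.MathematicalPhysics.QuantumFieldTheory.Balaban1983to89.B7Prop1Explicit
  (Site Letter e disp disp_append disp_cons disp_nil disp_replicate plaqWord revWord)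
open NonAbelianStokesDisc
open NonAbelianStokesTransposition (swapMoves swapShift swapOrient glued_swapMoves_append)
open NonAbelianStokesPathPair (toFront sortMoves towerMoves pathPairScript build_toFront_append erase_replicate_append_cons glued_towerMoves_append
  build_towerMoves_append)

variable {d : ℕ}

/-! ## §1 The squares swept by one letter -/

section Sweep

/-- DATA.  The plaquettes glued while the letter `l` is carried leftward past the letters of `A` (which sit after the prefix `X`): the `k`-th letter
`a_k` contributes nothing if it is parallel to `l`, else the unit square at `x + disp (X ++ a_0 ⋯ a_{k−1}) + swapShift a_k l` read with orientation
`swapOrient a_k l` (outermost letter first). -/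
def sweep (x : Site d) (l : Letter d) : List (Letter d) → List (Letter d) → List (Site d × List (Letter d))
  | _, [] => []
  | X, a :: A => (if a.1 = l.1 then [] else [(x + disp X + swapShift a l, plaqWord (swapOrient a l).1 (swapOrient a l).2)]) ++ sweep x l (X ++ [a]) A

/-- **THE GLUED LIST OF `toFront` IN CLOSED FORM**: for `l ∉ A`, `build rest = X ++ (A ++ l :: B) ++ Z`, `|X| = n`,
`glued x (toFront l n (A ++ l :: B) ++ rest) = sweep x l X A ++ glued x rest`. [folklore] -/
theorem glued_toFront_append_of_not_mem (x : Site d) (l : Letter d) : ∀ (A X B Z : List (Letter d)) {n : ℕ}, X.length = n →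
    ∀ rest : List (Move d), build rest = X ++ (A ++ l :: B) ++ Z → l ∉ A →
      glued x (toFront l n (A ++ l :: B) ++ rest) = sweep x l X A ++ glued x rest
  | [], X, B, Z, n, hX, rest, hrest, _ => by rw [List.nil_append, toFront, if_pos rfl, sweep, List.nil_append, List.nil_append]
  | a :: A, X, B, Z, n, hX, rest, hrest, hl => by
    have hal : a ≠ l := fun h => hl (h ▸ List.mem_cons_self)
    have hlA : l ∉ A := fun h => hl (List.mem_cons_of_mem _ h)
    have ih := glued_toFront_append_of_not_mem x l A (X ++ [a]) B Z (n := n + 1) (by simp [hX]) rest (by rw [hrest]; simp) hlA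
    have hb : build (toFront l (n + 1) (A ++ l :: B) ++ rest) = X ++ a :: l :: (A ++ B ++ Z) := by
      rw [build_toFront_append l (A ++ l :: B) (X ++ [a]) Z (n := n + 1) (by simp [hX]) rest (by rw [hrest]; simp)
        (List.mem_append_right _ List.mem_cons_self), List.erase_append_right _ hlA, List.erase_cons_head]
      simp
    rw [List.cons_append, toFront, if_neg hal, List.append_assoc, glued_swapMoves_append a l x X (A ++ B ++ Z) hX _ hb, ih, sweep,
      List.append_assoc]

/-- **PAST A STRAIGHT SEGMENT** `c^L` the swept squares form the strip `x + disp X + k·vec c + swapShift c l`, `k = 0, …, L − 1` (nothing if `c ∥ l`). -/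
theorem sweep_replicate (x : Site d) (l c : Letter d) : ∀ (L : ℕ) (X : List (Letter d)),
    sweep x l X (List.replicate L c) =
      if c.1 = l.1 then [] else
        (List.range L).map fun k : ℕ => (x + disp X + (k : ℤ) • c.vec + swapShift c l, plaqWord (swapOrient c l).1 (swapOrient c l).2)
  | 0, X => by simp [sweep]
  | L + 1, X => by
    rw [List.replicate_succ, sweep, sweep_replicate x l c L (X ++ [c])]
    split_ifs with h
    · rfl
    · rw [List.range_succ_eq_map, List.map_cons, List.map_map, List.singleton_append]
      congr 1
      · simp
      · refine List.map_congr_left fun k _ => ?_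
        simp only [Function.comp_apply, disp_append, disp_cons, disp_nil, add_zero, Nat.cast_succ, add_smul, one_smul]
        refine Prod.ext ?_ rfl
        simp only
        abel

end Sweep

/-! ## §2 The swept region of the commuting instance -/

section Comm

/-- DATA.  The glued list of the commuting instance in closed form: letter `γ` of `Γ` (after the prefix `X`) contributes `sweep x γ X c^L` unless
`γ = c` (then it is found at once); deeper letters are listed first. -/
def commGlued (x : Site d) (c : Letter d) (L : ℕ) : List (Letter d) → List (Letter d) → List (Site d × List (Letter d))
  | _, [] => []
  | X, γ :: Γ => commGlued x c L (X ++ [γ]) Γ ++ (if γ = c then [] else sweep x γ X (List.replicate L c))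

/-- Sorting a constant word into itself glues nothing. -/
theorem glued_sortMoves_replicate_self (x : Site d) (c : Letter d) : ∀ (L n : ℕ) (rest : List (Move d)),
    glued x (sortMoves n (List.replicate L c) (List.replicate L c) ++ rest) = glued x rest
  | 0, _, _ => by simp [sortMoves]
  | L + 1, n, rest => by
    rw [List.replicate_succ, sortMoves, List.erase_cons_head, List.append_assoc, glued_sortMoves_replicate_self x c L (n + 1), toFront,
      if_pos rfl, List.nil_append]

/-- **THE GLUED LIST OF THE COMMUTING SORT IN CLOSED FORM**: `build rest = X ++ (c^L ++ Γ) ++ Z`, `|X| = n` ⟹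
`glued x (sortMoves n (Γ ++ c^L) (c^L ++ Γ) ++ rest) = commGlued x c L X Γ ++ glued x rest`. [folklore] -/
theorem glued_sortMoves_comm_replicate (x : Site d) (c : Letter d) (L : ℕ) : ∀ (Γ X Z : List (Letter d)) {n : ℕ}, X.length = n →
    ∀ rest : List (Move d), build rest = X ++ (List.replicate L c ++ Γ) ++ Z →
      glued x (sortMoves n (Γ ++ List.replicate L c) (List.replicate L c ++ Γ) ++ rest) = commGlued x c L X Γ ++ glued x rest
  | [], X, Z, n, hX, rest, hrest => by
    rw [List.nil_append, List.append_nil, glued_sortMoves_replicate_self, commGlued, List.nil_append]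
  | γ :: Γ, X, Z, n, hX, rest, hrest => by
    have hmem : γ ∈ List.replicate L c ++ γ :: Γ := List.mem_append_right _ List.mem_cons_self
    have hb : build (toFront γ n (List.replicate L c ++ γ :: Γ) ++ rest) = (X ++ [γ]) ++ (List.replicate L c ++ Γ) ++ Z := by
      rw [build_toFront_append γ _ X Z hX rest hrest hmem, erase_replicate_append_cons]; simp
    have ih := glued_sortMoves_comm_replicate x c L Γ (X ++ [γ]) Z (n := n + 1) (by simp [hX]) _ hb
    rw [List.cons_append, sortMoves, erase_replicate_append_cons, List.append_assoc, ih, commGlued, List.append_assoc]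
    congr 1
    by_cases hγ : γ = c
    · subst hγ
      rw [if_pos rfl, List.nil_append]
      cases L with
      | zero => rw [List.replicate_zero, List.nil_append, toFront, if_pos rfl, List.nil_append]
      | succ L => rw [List.replicate_succ, List.cons_append, toFront, if_pos rfl, List.nil_append]
    · rw [if_neg hγ]
      have hnot : γ ∉ List.replicate L c := fun h => hγ (List.eq_of_mem_replicate h)
      exact glued_toFront_append_of_not_mem x γ (List.replicate L c) X Γ Z hX rest hrest hnot

/-- **THE SWEPT REGION OF THE PATH PAIR `Γ S` vs `S Γ` IN CLOSED FORM** (`S = c^L`): `glued x (pathPairScript (Γ ++ S) (S ++ Γ)) = commGlued x c L [] Γ` —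
letter `γ_m` of `Γ` sweeps the strip of `L` unit squares based at `x + disp(γ_1 ⋯ γ_{m−1})` along `c` (`sweep_replicate`), none if `γ_m ∥ c`. [folklore] -/
theorem glued_pathPairScript_comm_replicate (x : Site d) (Γ : List (Letter d)) (c : Letter d) (L : ℕ) :
    glued x (pathPairScript (Γ ++ List.replicate L c) (List.replicate L c ++ Γ)) = commGlued x c L [] Γ := by
  have hb : build (towerMoves 0 (List.replicate L c ++ Γ) ++ ([] : List (Move d))) =
      [] ++ (List.replicate L c ++ Γ) ++ revWord (List.replicate L c ++ Γ) := by
    rw [build_towerMoves_append _ [] [] (n := 0) rfl [] rfl, List.append_nil]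
  rw [pathPairScript, ← List.append_nil (sortMoves 0 _ _ ++ towerMoves 0 _), List.append_assoc,
    glued_sortMoves_comm_replicate x c L Γ [] _ (n := 0) rfl _ hb, glued_towerMoves_append, glued, List.append_nil]

end Comm

/-! ## §3 Toy -/

/-- `Γ = a⁺` carried past `S = b⁺ b⁺` (`a ≠ b`): two unit squares, at `x` and at `x + e_b`, both `∂p_{ab}`. -/
example (x : Site d) (a b : Fin d) (hab : a ≠ b) :
    glued x (pathPairScript ([((a, true) : Letter d)] ++ List.replicate 2 (b, true)) (List.replicate 2 (b, true) ++ [((a, true) : Letter d)])) =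
      [(x, plaqWord a b), (x + e b, plaqWord a b)] := by
  rw [glued_pathPairScript_comm_replicate]
  simp [commGlued, sweep, swapShift, swapOrient, hab, Ne.symm hab]

end Summit.QuantumFields.BalabanUV.T4Continuum.NE7b.NonAbelianStokesPathPairLocus
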